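import Summits.ResolutionOfSingularities.ResolutionOfSingularities.Theorems.ConeChainLetters
import HarnessLib

/-! # ConeChainAlgebra — decomp-res-lens-4 g42 node «ConeChain», FILE B (§145: LAW B at GRADED-ALGEBRA level — a `τ = 1` homogeneous
ideal containing a cone presentation `ā·X_{j₀}^n + X_j·H` has its directrix inside `κ X_{j₀} + κ X_j` and cannot contain `b̄·X_j^n`
(`directrix_apply_single_eq_zero_of_conePresentation`, `false_of_conePresentation_of_C_mul_X_pow_mem`; tools `killY`, `keepVar`) — and
at RING level in a regular local ring with an rsop (`exists_conePresentation_mem_initialForms`; (B0) `not_isAdapted_of_conePresentation`,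
(B1) `isAdapted_of_conePresentation`, (B2) `false_of_conePresentation_of_coneWitness_exc`, (B1′) `mem_span_pair_sup_sq_of_conePresentation`).
VERBATIM slice of HOME/decomp-res-lens-4/g42/ConeChain.lean. -/


noncomputable section

open CategoryTheory AlgebraicGeometry IsLocalRing TopologicalSpace MvPolynomial
open Literature.AlgebraicGeometry.Resolution
open Summit.ResolutionOfSingularities.ResolutionOfSingularities.Theorems
open WeakOrderReduction ForcedTowerClasses DivergentTowerClasses MonomialTowerClasses
open HugDimensionClasses HugDimensionKernels SurfaceShadowClasses SurfaceShadowKernels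
open NearPointCut (SingularClass)
open Scheme.IdealSheafData (vanishingIdeal)

universe u

namespace Summit.ResolutionOfSingularities.ResolutionOfSingularities.Theorems.HugValuationCut

/-! ## ══ FILE B `Theorems/ConeChainAlgebra.lean` (§145; imports FILE A) ══ -/

/-! ## §145 (g42 · NEW · LAW B, GRADED-ALGEBRA AND RING LEVEL) THE CONE PRESENTATION `ā·X_{j₀}^n + X_j·H` IN A `τ = 1` HOMOGENEOUS IDEAL -/

section ConeAlgebra

variable {k : Type u} [Field k] {d : ℕ}

/-- the evaluation `Y_i ↦ 0`, `T ↦ 1` of `k[Y, T]`. -/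
def killY (d : ℕ) : MvPolynomial (Option (Fin d)) k →ₐ[k] k :=
  aeval fun o : Option (Fin d) => o.elim 1 fun _ => 0

/-- `killY (T) = 1`. [definitional] -/
@[simp] theorem killY_X_none : killY (k := k) d (X none) = 1 := by simp [killY]

/-- `killY (Y_i) = 0`. [definitional] -/
@[simp] theorem killY_X_some (i : Fin d) : killY (k := k) d (X (some i)) = 0 := by simp [killY]

/-- `killY` fixes constants. [definitional] -/
@[simp] theorem killY_C (b : k) : killY (k := k) d (C b) = b := by simp [killY]

/-- `killY` fixes scalars. [definitional] -/
@[simp] theorem killY_algebraMap (b : k) : killY (k := k) d (algebraMap k _ b) = b := by simp [killY]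

/-- `killY` annihilates every linear form in the `Y`-variables. [folklore] -/
theorem killY_rename_linearFormPoly (ℓ : Module.Dual k (Fin d → k)) :
    killY d (rename some (linearFormPoly k ℓ)) = 0 := by
  rw [linearFormPoly, map_sum, map_sum]
  refine Finset.sum_eq_zero fun i _ => ?_
  rw [map_mul, rename_C, rename_X, map_mul, killY_X_some, mul_zero]

/-- **PURE-POWER LEMMA**: if `b·L^n ∈ S` (`b ≠ 0`, `n ≥ 1`) for the linear form `L` of `ℓ`, then `ℓ` lies in the directrix `T(S)`. -/
theorem mem_directrix_of_C_mul_pow_mem {S : Set (MvPolynomial (Fin d) k)} {ℓ : Module.Dual k (Fin d → k)} {b : k}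
    (hb : b ≠ 0) {n : ℕ} (hn : 1 ≤ n) (hS : C b * linearFormPoly k ℓ ^ n ∈ S) : ℓ ∈ directrix k S := by
  rw [mem_directrix_iff]
  intro w hw
  have h := (mem_invarianceSpace_iff k).mp hw _ hS
  rw [map_mul, map_pow, rename_C, map_mul, map_pow, translate_rename_linearFormPoly, algHom_C] at h
  have h' := congrArg (killY d) h
  rw [map_mul, map_pow, map_add, map_mul, killY_rename_linearFormPoly, killY_algebraMap, killY_X_none,
    map_mul, map_pow, killY_rename_linearFormPoly, killY_C, killY_C, zero_add, mul_one, zero_pow (by omega), mul_zero,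
    mul_eq_zero] at h'
  rcases h' with h' | h'
  · exact absurd h' hb
  · exact pow_eq_zero_iff (by omega) |>.mp h'

/-- the evaluation `Y_l ↦ X`, `Y_i ↦ 0 (i ≠ l)` into `k[X]`. -/
def keepVar (l : Fin d) : MvPolynomial (Fin d) k →ₐ[k] Polynomial k :=
  aeval fun i => if i = l then Polynomial.X else 0

/-- `keepVar l (Y_l) = X`. [definitional] -/
@[simp] theorem keepVar_X_self (l : Fin d) : keepVar (k := k) l (X l) = Polynomial.X := by simp [keepVar]

/-- `keepVar l (Y_i) = 0` for `i ≠ l`. [definitional] -/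
theorem keepVar_X_of_ne {l i : Fin d} (h : i ≠ l) : keepVar (k := k) l (X i) = 0 := by simp [keepVar, h]

/-- `keepVar l` of a linear form is `ℓ(e_l)·X`. [folklore] -/
theorem keepVar_linearFormPoly (l : Fin d) (ℓ : Module.Dual k (Fin d → k)) :
    keepVar l (linearFormPoly k ℓ) = Polynomial.C (ℓ (Pi.single l 1)) * Polynomial.X := by
  classical
  rw [linearFormPoly, map_sum, Finset.sum_eq_single l]
  · rw [map_mul, MvPolynomial.algHom_C, keepVar_X_self, Polynomial.algebraMap_eq]
  · intro i _ hi
    rw [map_mul, keepVar_X_of_ne hi, mul_zero]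
  · exact fun h => (h (Finset.mem_univ l)).elim

/-- **TANGENCY LEMMA (pure algebra)**: if `τ(S) = 1` and `S` contains `G₀ = a·Y_{j₀}^n + Y_j·H` with `a ≠ 0`, `n ≥ 1`, then every
form of the directrix kills `e_l` for every third index `l ∉ {j₀, j}`. -/
theorem directrix_apply_single_eq_zero_of_conePresentation {S : Set (MvPolynomial (Fin d) k)} (hτ : hironakaTau k S = 1)
    {j₀ j l : Fin d} (hj : j ≠ j₀) (hl₀ : l ≠ j₀) (hlj : l ≠ j) {a : k} (ha : a ≠ 0) {n : ℕ} (hn : 1 ≤ n)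
    {H : MvPolynomial (Fin d) k} (hG : C a * X j₀ ^ n + X j * H ∈ S)
    {ℓ : Module.Dual k (Fin d → k)} (hℓ : ℓ ∈ directrix k S) : ℓ (Pi.single l 1) = 0 := by
  classical
  by_contra hγ
  have hℓ0 : ℓ ≠ 0 := by rintro rfl; exact hγ rfl
  -- `T(S) = k·ℓ`
  have hspan : ∀ m ∈ directrix k S, ∃ c : k, c • ℓ = m := by
    intro m hm
    have h1 := (finrank_eq_one_iff_of_nonzero' (⟨ℓ, hℓ⟩ : directrix k S) (by
      intro h; exact hℓ0 (congrArg Subtype.val h))).mp (by rw [← hironakaTau]; exact hτ) ⟨m, hm⟩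
    obtain ⟨c, hc⟩ := h1
    exact ⟨c, congrArg Subtype.val hc⟩
  -- `S ⊆ k[L]`, `L` the linear form of `ℓ`
  have hsub : linearFormsSubalgebra k (directrix k S) ≤ Algebra.adjoin k {linearFormPoly k ℓ} := by
    refine Algebra.adjoin_le ?_
    rintro _ ⟨m, hm, rfl⟩
    obtain ⟨c, rfl⟩ := hspan m hm
    rw [linearFormPoly_smul, C_mul']
    exact Subalgebra.smul_mem _ (Algebra.self_mem_adjoin_singleton k _) c
  have hmem : C a * X j₀ ^ n + X j * H ∈ Algebra.adjoin k {linearFormPoly k ℓ} :=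
    hsub (subset_linearFormsSubalgebra_directrix k S hG)
  rw [Algebra.adjoin_singleton_eq_range_aeval] at hmem
  obtain ⟨P, hP⟩ := hmem
  -- kill every variable but `Y_l`
  have hkill : keepVar l (C a * X j₀ ^ n + X j * H) = 0 := by
    rw [map_add, map_mul, map_mul, map_pow, keepVar_X_of_ne hl₀.symm, keepVar_X_of_ne hlj.symm, zero_pow (by omega),
      mul_zero, zero_mul, add_zero]
  have hP : Polynomial.aeval (linearFormPoly k ℓ) P = C a * X j₀ ^ n + X j * H := hP
  have hP' : P.comp (Polynomial.C (ℓ (Pi.single l 1)) * Polynomial.X) = 0 := by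
    rw [Polynomial.comp_eq_aeval, ← keepVar_linearFormPoly, Polynomial.aeval_algHom_apply, hP, hkill]
  rw [Polynomial.comp_eq_zero_iff] at hP'
  rcases hP' with hP0 | ⟨-, hq⟩
  · have h0 : C a * X j₀ ^ n + X j * H = 0 := by rw [← hP, hP0, map_zero]
    have hcoeff := congrArg (coeff (Finsupp.single j₀ n)) h0
    have hjs : j ∉ (Finsupp.single j₀ n).support := by
      simp [Finsupp.mem_support_iff, hj.symm]
    rw [coeff_add, coeff_C_mul, coeff_X_pow, if_pos rfl, mul_one, coeff_X_mul', if_neg hjs, add_zero, coeff_zero] at hcoeff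
    exact ha hcoeff
  · have h2 := congrArg (Polynomial.coeff · 1) hq
    rw [Polynomial.coeff_C_mul, Polynomial.coeff_X_one, mul_one, Polynomial.coeff_C, if_neg one_ne_zero] at h2
    exact hγ h2

/-- **NO-EXCEPTIONAL-CONE LEMMA (pure algebra, τ-free)**: if `S` contains `G₀ = a·Y_{j₀}^n + Y_j·H` (`a ≠ 0`, `n ≥ 1`,
`j ≠ j₀`), then `e_{j₀}` is NOT an invariance direction of `S`. -/
theorem single_not_mem_invarianceSpace_of_conePresentation {S : Set (MvPolynomial (Fin d) k)} {j₀ j : Fin d}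
    (hj : j ≠ j₀) {a : k} (ha : a ≠ 0) {n : ℕ} (hn : 1 ≤ n) {H : MvPolynomial (Fin d) k}
    (hG : C a * X j₀ ^ n + X j * H ∈ S) : Pi.single j₀ (1 : k) ∉ invarianceSpace k S := by
  intro hw
  have h' := congrArg (killY d) ((mem_invarianceSpace_iff k).mp hw _ hG)
  simp only [map_add, map_mul, map_pow, rename_X, algHom_C, AlgHom.commutes, translate_X_some, Pi.single_eq_same,
    Pi.single_eq_of_ne hj, killY_X_some, killY_X_none, map_zero, map_one, zero_add, add_zero,
    mul_one, one_pow, zero_mul, mul_zero, zero_pow (by omega : n ≠ 0)] at h'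
  exact ha h'

/-- **EXCEPTIONAL-CONE EXCLUSION (pure algebra)**: under `τ(S) = 1`, `S` cannot contain both a cone presentation
`a·Y_{j₀}^n + Y_j·H` and a pure power `b·Y_j^n` of the OTHER variable (`a, b ≠ 0`, `n ≥ 1`, `j ≠ j₀`). -/
theorem false_of_conePresentation_of_C_mul_X_pow_mem {S : Set (MvPolynomial (Fin d) k)} (hτ : hironakaTau k S = 1)
    {j₀ j : Fin d} (hj : j ≠ j₀) {a b : k} (ha : a ≠ 0) (hb : b ≠ 0) {n : ℕ} (hn : 1 ≤ n) {H : MvPolynomial (Fin d) k}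
    (hG : C a * X j₀ ^ n + X j * H ∈ S) (hX : C b * X j ^ n ∈ S) : False := by
  classical
  -- the coordinate form `Y_j` lies in the directrix
  have hproj : (LinearMap.proj j : Module.Dual k (Fin d → k)) ∈ directrix k S := by
    refine mem_directrix_of_C_mul_pow_mem hb hn ?_
    have : linearFormPoly k (LinearMap.proj j : Module.Dual k (Fin d → k)) = X j := by
      rw [linearFormPoly, Finset.sum_eq_single j]
      · simp
      · intro i _ hi; simp [Pi.single_eq_of_ne hi.symm]
      · exact fun h => (h (Finset.mem_univ j)).elim
    rw [this]; exact hX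
  have hproj0 : (LinearMap.proj j : Module.Dual k (Fin d → k)) ≠ 0 := by
    intro h; have := congrArg (fun f : Module.Dual k (Fin d → k) => f (Pi.single j 1)) h; simp at this
  -- `T(S) = k·proj_j`, hence `e_{j₀} ∈ 𝕎(S) = T(S)^⊥`
  have hspan : ∀ m ∈ directrix k S, ∃ c : k, c • (LinearMap.proj j : Module.Dual k (Fin d → k)) = m := by
    intro m hm
    obtain ⟨c, hc⟩ := (finrank_eq_one_iff_of_nonzero' (⟨_, hproj⟩ : directrix k S) (by
      intro h; exact hproj0 (congrArg Subtype.val h))).mp (by rw [← hironakaTau]; exact hτ) ⟨m, hm⟩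
    exact ⟨c, congrArg Subtype.val hc⟩
  refine single_not_mem_invarianceSpace_of_conePresentation hj ha hn hG ?_
  have hW : invarianceSpace k S = (directrix k S).dualCoannihilator := by
    rw [directrix, Subspace.dualAnnihilator_dualCoannihilator_eq]
  rw [hW, Submodule.mem_dualCoannihilator]
  intro m hm
  obtain ⟨c, rfl⟩ := hspan m hm
  simp [Pi.single_eq_of_ne hj]

end ConeAlgebra

/-! ## LAW B at RING level: the cone presentation `a·c_{j₀}^n + c_j·G ∈ J'` of a regular local ring -/

section RingLawB

variable {R : Type u} [CommRing R] [IsRegularLocalRing R] {d : ℕ}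

/-- a member of a regular system of parameters is not in `𝔪²`. [Matsumura Thm. 17.10] -/
theorem rsop_not_mem_sq (hd : (maximalIdeal R).spanFinrank = d) (c : Fin d → R)
    (hc : Ideal.span (Set.range c) = maximalIdeal R) (i : Fin d) : c i ∉ maximalIdeal R ^ 2 := by
  intro h
  have h0 := map_residue_eq_zero_of_eval_mem_pow_succ hd c hc (F := X i) (isHomogeneous_X _ i) (by rwa [eval_X])
  rw [map_X] at h0
  exact X_ne_zero i h0

/-- a member of a regular system of parameters lies in `𝔪`. [definitional] -/
theorem rsop_mem (c : Fin d → R) (hc : Ideal.span (Set.range c) = maximalIdeal R) (i : Fin d) : c i ∈ maximalIdeal R := by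
  rw [← hc]; exact Ideal.subset_span ⟨i, rfl⟩

/-- **The INITIAL FORM of a cone presentation**: if `a·c_{j₀}^n + c_j·G ∈ J ⊆ 𝔪^n` (`a` a unit, `n ≥ 1`, `j ≠ j₀`) then
`cl_n(J)` contains `ā·Y_{j₀}^n + Y_j·H` for some form `H` (order additivity: `G ∈ 𝔪^{n-1}`). [ZariskiSamuel VIII §1; folklore] -/
theorem exists_conePresentation_mem_initialForms (hd : (maximalIdeal R).spanFinrank = d) (c : Fin d → R)
    (hc : Ideal.span (Set.range c) = maximalIdeal R) {J : Ideal R} {n : ℕ} (hn : 1 ≤ n) (hJ : J ≤ maximalIdeal R ^ n)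
    {j₀ j : Fin d} {a G : R} (hf : a * c j₀ ^ n + c j * G ∈ J) :
    ∃ H : MvPolynomial (Fin d) (ResidueField R), C (residue R a) * X j₀ ^ n + X j * H ∈
      (initialForms c J n : Set (MvPolynomial (Fin d) (ResidueField R))) := by
  classical
  have hcj := rsop_mem c hc
  -- `c_j · G ∈ 𝔪^n`
  have hcG : c j * G ∈ maximalIdeal R ^ n := by
    have h1 : a * c j₀ ^ n ∈ maximalIdeal R ^ n := Ideal.mul_mem_left _ a (Ideal.pow_mem_pow (hcj j₀) n)
    simpa using Ideal.sub_mem _ (hJ hf) h1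
  -- `G ∈ 𝔪^{n-1}` (order additivity, `c_j ∉ 𝔪²`)
  have hG : G ∈ maximalIdeal R ^ (n - 1) := by
    rcases Nat.lt_or_ge n 2 with h1 | h2
    · have : n - 1 = 0 := by omega
      rw [this, pow_zero, Ideal.one_eq_top]; trivial
    · by_contra hG
      have h := mul_not_mem_pow_of_not_mem_pow (p := 1) (q := n - 2) (rsop_not_mem_sq hd c hc j)
        (by rwa [show n - 2 + 1 = n - 1 by omega])
      rw [show 1 + (n - 2) + 1 = n by omega] at h
      exact h hcG
  obtain ⟨H, hH, hHG⟩ := exists_isHomogeneous_eval_eq_of_mem_pow c hc hG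
  refine ⟨MvPolynomial.map (residue R) H, C a * X j₀ ^ n + X j * H, ?_, ?_, ?_⟩
  · refine (isHomogeneous_C_mul_X_pow a j₀ n).add ?_
    have h := (isHomogeneous_X R j).mul hH
    rwa [show 1 + (n - 1) = n by omega] at h
  · rwa [map_add, map_mul, eval_C, map_pow, eval_X, map_mul, eval_X, hHG]
  · rw [map_add, map_mul, map_C, map_pow, map_X, map_mul, map_X]

/-- **RING LAW B0 «no exceptional cone»** (τ-free): a cone presentation `a·c_{j₀}^n + c_j·G ∈ J` forbids `e_{j₀} ∈ 𝕎(cl_n J)`,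
i.e. `c` is NOT adapted to `J` at the index `j₀`. [NEW] -/
theorem not_isAdapted_of_conePresentation (hd : (maximalIdeal R).spanFinrank = d) (c : Fin d → R)
    (hc : Ideal.span (Set.range c) = maximalIdeal R) {J : Ideal R} {n : ℕ} (hn : 1 ≤ n) (hJ : J ≤ maximalIdeal R ^ n)
    {j₀ j : Fin d} (hj : j ≠ j₀) {a G : R} (ha : IsUnit a) (hf : a * c j₀ ^ n + c j * G ∈ J) : ¬ IsAdapted c J n j₀ := by
  obtain ⟨H, hH⟩ := exists_conePresentation_mem_initialForms hd c hc hn hJ hf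
  exact single_not_mem_invarianceSpace_of_conePresentation hj ((residue_ne_zero_iff_isUnit a).mpr ha) hn hH

/-- **RING LAW B1 «tangency»**: under `τ = 1`, a cone presentation `a·c_{j₀}^n + c_j·G ∈ J` makes `c` ADAPTED to `J` at every
third index `l ∉ {j₀, j}` (the directrix form involves only `Y_{j₀}, Y_j`). [NEW] -/
theorem isAdapted_of_conePresentation (hd : (maximalIdeal R).spanFinrank = d) (c : Fin d → R)
    (hc : Ideal.span (Set.range c) = maximalIdeal R) {J : Ideal R} {n : ℕ} (hn : 1 ≤ n) (hJ : J ≤ maximalIdeal R ^ n)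
    (hτ : hironakaTauAt c J n = 1) {j₀ j : Fin d} (hj : j ≠ j₀) {a G : R} (ha : IsUnit a) (hf : a * c j₀ ^ n + c j * G ∈ J)
    {l : Fin d} (hl₀ : l ≠ j₀) (hlj : l ≠ j) : IsAdapted c J n l := by
  obtain ⟨H, hH⟩ := exists_conePresentation_mem_initialForms hd c hc hn hJ hf
  have hτ' : hironakaTau (ResidueField R) (initialForms c J n : Set (MvPolynomial (Fin d) (ResidueField R))) = 1 := hτ
  exact isAdapted_of_forall_directrix fun ℓ hℓ =>
    directrix_apply_single_eq_zero_of_conePresentation hτ' hj hl₀ hlj ((residue_ne_zero_iff_isUnit a).mpr ha) hn hH hℓ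

/-- **The initial form of a cone witness**: `g ∈ J ⊆ 𝔪^n`, `g − b·z^n ∈ 𝔪^{n+1}` with `z = Z(c)` for a linear form `Z` ⇒
`b̄·Z̄^n ∈ cl_n(J)`. [folklore] -/
theorem C_mul_pow_mem_initialForms_of_sub_mem_pow_succ (hd : (maximalIdeal R).spanFinrank = d) (c : Fin d → R)
    (hc : Ideal.span (Set.range c) = maximalIdeal R) {J : Ideal R} {n : ℕ} (hJ : J ≤ maximalIdeal R ^ n)
    {Z : MvPolynomial (Fin d) R} (hZ : Z.IsHomogeneous 1) {g b : R} (hg : g ∈ J)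
    (hgz : g - b * eval c Z ^ n ∈ maximalIdeal R ^ (n + 1)) :
    C (residue R b) * MvPolynomial.map (residue R) Z ^ n ∈ (initialForms c J n : Set (MvPolynomial (Fin d) (ResidueField R))) := by
  obtain ⟨Γ, hΓ, hΓg⟩ := exists_isHomogeneous_eval_eq_of_mem_pow c hc (hJ hg)
  have hΓ' : (Γ - C b * Z ^ n).IsHomogeneous n := by
    refine hΓ.sub ?_
    simpa using (isHomogeneous_C _ b).mul (hZ.pow n)
  have hres := map_residue_eq_zero_of_eval_mem_pow_succ hd c hc hΓ'
    (by rwa [map_sub, map_mul, eval_C, map_pow, hΓg])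
  rw [map_sub, sub_eq_zero, map_mul, map_C, map_pow] at hres
  rw [← hres]
  exact ⟨Γ, hΓ, hΓg ▸ hg, rfl⟩

/-- **RING LAW B2 «the exceptional parameter is never a cone witness»**: under `τ = 1`, a cone presentation at `(j₀, j)` and
`g − b·c_j^n ∈ 𝔪^{n+1}` (`g ∈ J`, `b` a unit) are incompatible. [NEW] -/
theorem false_of_conePresentation_of_coneWitness_exc (hd : (maximalIdeal R).spanFinrank = d) (c : Fin d → R)
    (hc : Ideal.span (Set.range c) = maximalIdeal R) {J : Ideal R} {n : ℕ} (hn : 1 ≤ n) (hJ : J ≤ maximalIdeal R ^ n)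
    (hτ : hironakaTauAt c J n = 1) {j₀ j : Fin d} (hj : j ≠ j₀) {a G : R} (ha : IsUnit a) (hf : a * c j₀ ^ n + c j * G ∈ J)
    {g b : R} (hb : IsUnit b) (hg : g ∈ J) (hgb : g - b * c j ^ n ∈ maximalIdeal R ^ (n + 1)) : False := by
  obtain ⟨H, hH⟩ := exists_conePresentation_mem_initialForms hd c hc hn hJ hf
  have hX := C_mul_pow_mem_initialForms_of_sub_mem_pow_succ hd c hc hJ (Z := X j) (isHomogeneous_X R j) hg
    (by rwa [eval_X])
  rw [map_X] at hX
  have hτ' : hironakaTau (ResidueField R) (initialForms c J n : Set (MvPolynomial (Fin d) (ResidueField R))) = 1 := hτ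
  exact false_of_conePresentation_of_C_mul_X_pow_mem hτ' hj ((residue_ne_zero_iff_isUnit a).mpr ha)
    ((residue_ne_zero_iff_isUnit b).mpr hb) hn hH hX

/-- **RING LAW B1′ «every cone witness lies in the flag»**: under `τ = 1` and a cone presentation at `(j₀, j)`, any `z ∈ 𝔪` with
`g − b·z^n ∈ 𝔪^{n+1}` (`g ∈ J`, `b` a unit) lies in `(c_{j₀}, c_j) + 𝔪²`. [NEW] -/
theorem mem_span_pair_sup_sq_of_conePresentation (hd : (maximalIdeal R).spanFinrank = d) (c : Fin d → R)
    (hc : Ideal.span (Set.range c) = maximalIdeal R) {J : Ideal R} {n : ℕ} (hn : 1 ≤ n) (hJ : J ≤ maximalIdeal R ^ n)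
    (hτ : hironakaTauAt c J n = 1) {j₀ j : Fin d} (hj : j ≠ j₀) {a G : R} (ha : IsUnit a) (hf : a * c j₀ ^ n + c j * G ∈ J)
    {z g b : R} (hz : z ∈ maximalIdeal R) (hb : IsUnit b) (hg : g ∈ J) (hgz : g - b * z ^ n ∈ maximalIdeal R ^ (n + 1)) :
    z ∈ Ideal.span {c j₀, c j} ⊔ maximalIdeal R ^ 2 := by
  classical
  rw [← hc, Ideal.mem_span_range_iff_exists_fun] at hz
  obtain ⟨w, rfl⟩ := hz
  -- the linear form `Z = Σ w_i Y_i` and its residue functional `ℓ`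
  set Z : MvPolynomial (Fin d) R := ∑ i, C (w i) * X i with hZdef
  have hZ : Z.IsHomogeneous 1 := by
    refine IsHomogeneous.sum _ _ _ fun i _ => ?_
    simpa using isHomogeneous_C_mul_X_pow (w i) i 1
  have hZc : eval c Z = ∑ i, w i * c i := by simp [hZdef, eval_X]
  let ℓ : Module.Dual (ResidueField R) (Fin d → ResidueField R) := ∑ i, residue R (w i) • LinearMap.proj i
  have hℓi : ∀ i, ℓ (Pi.single i 1) = residue R (w i) := by
    intro i
    simp only [ℓ, LinearMap.sum_apply, LinearMap.smul_apply, LinearMap.coe_proj, Function.eval, smul_eq_mul]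
    rw [Finset.sum_eq_single i]
    · simp
    · intro b _ hb; rw [Pi.single_eq_of_ne hb, mul_zero]
    · exact fun h => (h (Finset.mem_univ i)).elim
  have hℓZ : linearFormPoly (ResidueField R) ℓ = MvPolynomial.map (residue R) Z := by
    simp only [linearFormPoly, hℓi, hZdef, map_sum, map_mul, map_C, map_X]
  -- `b̄·Z̄^n ∈ cl_n(J)` hence `ℓ ∈ T`
  have hmem := C_mul_pow_mem_initialForms_of_sub_mem_pow_succ hd c hc hJ hZ hg (by rwa [hZc])
  rw [← hℓZ] at hmem
  have hℓT := mem_directrix_of_C_mul_pow_mem ((residue_ne_zero_iff_isUnit b).mpr hb) hn hmem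
  -- every third coefficient of `Z` lies in `𝔪`
  have hw : ∀ l, l ≠ j₀ → l ≠ j → w l ∈ maximalIdeal R := by
    intro l hl₀ hlj
    have h := (isAdapted_of_conePresentation hd c hc hn hJ hτ hj ha hf hl₀ hlj).apply_single_eq_zero hℓT
    rw [hℓi] at h
    exact (residue_eq_zero_iff _).mp h
  refine Ideal.sum_mem _ fun i _ => ?_
  by_cases hi₀ : i = j₀
  · subst hi₀
    exact Ideal.mem_sup_left (Ideal.mul_mem_left _ _ (Ideal.subset_span (by simp)))
  by_cases hij : i = j
  · subst hij
    exact Ideal.mem_sup_left (Ideal.mul_mem_left _ _ (Ideal.subset_span (by simp)))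
  · refine Ideal.mem_sup_right ?_
    rw [pow_two]
    exact Ideal.mul_mem_mul (hw i hi₀ hij) (rsop_mem c hc i)

end RingLawB

end Summit.ResolutionOfSingularities.ResolutionOfSingularities.Theorems.HugValuationCut
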